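import Summits.Ventures.HSemireg.WedgeHankelFrameChange
import Summits.Ventures.HSemireg.WedgeHankelTwoNodes

/-!
# Venture HSemireg — THE TWO-NODE CONFLUENT KERNEL LAW at a FINITE node `λ` and the node `∞`: the class `exp(λΘ)·(Σ_{p≤P} q_p Θ^p/p!) + (top window of
# length P′+1)` has kernel `SI_k ⊕ Φs λ (xyRich(k, P, P′))` for `k ≤ n − P − P′ − 1` — E8 transported by E5's frame change

HONEST FRAMING. Part of the Lean index of the computation cell `pub-hsemireg` (seat p10 gen 15, Sunday typer «UNIFORM-IN-n»).
Finite-dimensional EXTERIOR ALGEBRA over a field ONLY: no variety, no cohomology theory, no sheaf, no Ext group, no semiregularity map;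
nothing here says that HC / HC_CM / HC_AV holds; no Literature fact is declared or used.  Custodian versions as in `WedgeHankelSiegelIdeal` (1/3),
`WedgeHankelFrameChange`, `WedgeHankelTwoNodes`; the dictionary (`exp(λΘ)·v` ↦ `expMul λ q`; the top window ↦ an order-`(P′+1)` node at `∞`) is QUOTED,
never asserted.

THIS FILE (continues namespace `Summit.Ventures.HSemireg.Wedge.HankelFrameChange`; imports E5 and E8):
* §37 the binomial transform is a ONE-PARAMETER GROUP: `expMul_zero_left` (`expMul 0 = id`), **`expMul_expMul`: `expMul a (expMul b q) = expMul (a+b) q`**;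
  it preserves «supported on the top window `[N, ∞)`» with the same leading entry (`expMul_apply_eq_zero_of_lt`, `expMul_apply_of_vanish_below`).
* §38 **`Kr_w_expMul_add_top`: for `q₁` supported on `[0, P]` with `q₁ P ≠ 0`, `s` vanishing below `n − P′` with `s (n − P′) ≠ 0`, and `k + P + P′ + 1 ≤ n`:
  `Kr(univ, w_n(expMul λ q₁ + s), k) = SI_k ⊔ Φs λ (xyRich(k, P, P′))`** — the class `exp(λΘ)·p(Θ) + (order-(P′+1) node at ∞)` (write it as
  `exp(λΘ)·(p + exp(−λΘ)·s)`, E8 at `(0, ∞)`, E5's transport); `P = P′ = 0`: **`Kr_w_exp_add_point'`: `Kr(univ, w_n(A λ^• + c δ_n), k) = Φs λ (xyRich(k,0,0))`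
  EXACTLY** — gen 14's `Kr_w_exp_add_point` (`F_λ(k) ∩ F_∞(k)`) recovered with multiplicities available.
NOT typed here: two FINITE nodes `λ ≠ μ` — transport `(0, ∞) ↦ (λ, μ)` by `Φs λ ∘ (Ψs ∘ Φs (1/(μ−λ)) ∘ Ψs)` (E7's swap conjugates the shear into `y_a ↦ y_a + c x_a`);
the missing piece is only the identification of the transported SEQUENCE with `expMul λ q₁ + expMul μ q₂` (reversal ∘ binomial transform on polynomial
sequences), not the kernel statement; three or more nodes; anything Ext-side.  Class side only.
-/

open Module

namespace Summit.Ventures.HSemireg.Wedge.HankelFrameChange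

open Summit.Ventures.HSemireg.Wedge Summit.Ventures.HSemireg.Wedge.Kunneth Summit.Ventures.HSemireg.Wedge.Hankel
  Summit.Ventures.HSemireg.Wedge.BasisFree Summit.Ventures.HSemireg.Wedge.HankelSiegel Summit.Ventures.HSemireg.Wedge.HankelSiegelIdeal
  Summit.Ventures.HSemireg.Wedge.KunnethKernel

variable (K : Type*) [Field K] {n : ℕ}

/-! ## §37. The binomial transform is a one-parameter group; top windows stay top windows -/

/-- `expMul 0 = id`. -/
theorem expMul_zero_left (q : ℕ → K) (j : ℕ) : expMul K 0 q j = q j := by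
  induction j generalizing q with
  | zero => rfl
  | succ j ih => rw [expMul_succ, zero_mul, zero_add, ih, shift_apply]

/-- **`expMul a (expMul b q) = expMul (a + b) q`** — `exp(aΘ)·(exp(bΘ)·v) = exp((a+b)Θ)·v`. -/
theorem expMul_expMul (a c : K) (q : ℕ → K) (j : ℕ) : expMul K a (expMul K c q) j = expMul K (a + c) q j := by
  induction j generalizing q with
  | zero => rfl
  | succ j ih =>
    have hs : shift K (expMul K c q) = fun i => c * expMul K c q i + expMul K c (shift K q) i := funext (shift_expMul K c q)
    rw [expMul_succ, expMul_succ, hs, expMul_add, expMul_smul, ih, ih]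
    ring

/-- `expMul (−a)` undoes `expMul a`. -/
theorem expMul_neg_expMul (a : K) (q : ℕ → K) (j : ℕ) : expMul K a (expMul K (-a) q) j = q j := by
  rw [expMul_expMul, add_neg_cancel, expMul_zero_left]

/-- as functions. -/
theorem expMul_neg_expMul' (a : K) (q : ℕ → K) : expMul K a (expMul K (-a) q) = q := funext (expMul_neg_expMul K a q)

/-- a sequence vanishing below `N` stays vanishing below `N` under the binomial transform. -/
theorem expMul_apply_eq_zero_of_lt (lam : K) {N : ℕ} {s : ℕ → K} (hs : ∀ i, i < N → s i = 0) {j : ℕ} (hj : j < N) :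
    expMul K lam s j = 0 := by
  rw [expMul_eq_sum]
  refine Finset.sum_eq_zero fun i hi => ?_
  rw [Finset.mem_range] at hi
  rw [hs i (by omega), mul_zero]

/-- … and keeps its first entry: `(expMul λ s)_N = s_N`. -/
theorem expMul_apply_of_vanish_below (lam : K) {N : ℕ} {s : ℕ → K} (hs : ∀ i, i < N → s i = 0) : expMul K lam s N = s N := by
  rw [expMul_eq_sum, Finset.sum_eq_single N]
  · simp
  · intro i hi hiN
    rw [Finset.mem_range] at hi
    rw [hs i (by omega), mul_zero]
  · intro h; exact absurd (Finset.mem_range.mpr (by omega)) h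

/-! ## §38. The two-node law at `(λ, ∞)` -/

/-- **THE TWO-NODE CONFLUENT KERNEL LAW AT `(λ, ∞)`**: `q₁` supported on `[0, P]` with `q₁ P ≠ 0`, `s` vanishing below `n − P′` with `s (n−P′) ≠ 0`,
`k + P + P′ + 1 ≤ n` ⇒ **`Kr(univ, w_n(expMul λ q₁ + s), k) = SI_k ⊔ Φs λ (xyRich(k, P, P′))`** — the Siegel ideal plus the forms with more than `P` letters from
the frame `{x_a + λ y_a}` and more than `P′` y-letters. -/
theorem Kr_w_expMul_add_top (lam : K) {k P P' : ℕ} (hkP : k + P + P' + 1 ≤ n) {q₁ s : ℕ → K} (hq₁ : ∀ j, P < j → q₁ j = 0) (hq₁P : q₁ P ≠ 0)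
    (hs : ∀ j, j < n - P' → s j = 0) (hsP : s (n - P') ≠ 0) :
    Kr K Finset.univ (w K n n (fun j => expMul K lam q₁ j + s j)) k =
      siegelIdeal K n k ⊔ (xyRich K n k P P').map (Φs K (n := n) lam).toLinearMap := by
  -- write the class as exp(λΘ)·(q₁ + exp(−λΘ)·s): a (0, ∞) two-node sequence
  set q₀ : ℕ → K := fun j => q₁ j + expMul K (-lam) s j with hq₀
  have e : (fun j => expMul K lam q₁ j + s j) = expMul K lam q₀ := by
    funext j; rw [hq₀, expMul_add, expMul_neg_expMul]
  have hmid : ∀ j, P < j → j < n - P' → q₀ j = 0 := fun j hj hj' => by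
    simp only [hq₀]; rw [hq₁ j hj, expMul_apply_eq_zero_of_lt K (-lam) hs hj', add_zero]
  have h0 : q₀ P ≠ 0 := by
    simp only [hq₀]; rwa [expMul_apply_eq_zero_of_lt K (-lam) hs (by omega), add_zero]
  have htop : q₀ (n - P') ≠ 0 := by
    simp only [hq₀]; rwa [hq₁ _ (by omega), zero_add, expMul_apply_of_vanish_below K (-lam) hs]
  rw [e, Kr_w_expMul, Kr_w_eq_of_two_orders K hkP hmid h0 htop, Submodule.map_sup, map_Φs_siegelIdeal]

/-- **THE PURE CLASS AT `λ` PLUS THE POINT: `Kr(univ, w_n(A λ^• + c·δ_n), k) = Φs λ (xyRich(k, 0, 0))`** (`A, c ≠ 0`, `k + 1 ≤ n`) — gen 14's `F_λ(k) ∩ F_∞(k)`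
(there from the rank of a point-secant, here with the orders `(0,0)` of the two-node law). -/
theorem Kr_w_exp_add_point' (lam : K) {k : ℕ} (hk : k + 1 ≤ n) {A c : K} (hA : A ≠ 0) (hc : c ≠ 0) :
    Kr K Finset.univ (w K n n (fun j => A * lam ^ j + if j = n then c else 0)) k = (xyRich K n k 0 0).map (Φs K (n := n) lam).toLinearMap := by
  have e : (fun j => A * lam ^ j + if j = n then c else 0) =
      fun j => expMul K lam (fun i => if i = 0 then A else 0) j + (fun i => if i = n then c else (0 : K)) j := by
    funext j; rw [expMul_spike_zero]
  rw [e, Kr_w_expMul_add_top K lam (P := 0) (P' := 0) (by omega) (fun j hj => if_neg (by omega)) (by rwa [if_pos rfl])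
      (fun j hj => if_neg (by omega)) (by rwa [Nat.sub_zero, if_pos rfl]), sup_eq_right]
  -- Φs λ fixes SI_k, so SI_k = Φs(SI_k) ≤ Φs(xyRich(k,0,0))
  calc siegelIdeal K n k = (siegelIdeal K n k).map (Φs K (n := n) lam).toLinearMap := (map_Φs_siegelIdeal K lam k).symm
    _ ≤ (xyRich K n k 0 0).map (Φs K (n := n) lam).toLinearMap := Submodule.map_mono (siegelIdeal_le_xyRich_zero K k)

end Summit.Ventures.HSemireg.Wedge.HankelFrameChange
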